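import Literature.Probability.RandomPlanarGeometry.SAWWordBridges
import Mathlib.Analysis.SpecialFunctions.Pow.Real
import Mathlib.Analysis.SpecificLimits.Basic

/-!
# Sub-goal `lacunaryRenewal_noPolynomialFloor` of the line `subcritical-renewal-floor`
(crux `TubeLowerBound`, stmt-CriticalPhenomena-4730): anti-lacunarity is a genuine extra input

At `x_c` the masses `p_L` of the irreducible bridges of span `L` form a probability law (Kesten)
and the bridge masses `u_L` by span are its renewal sequence,
`u₀ = 1`, `u_{n+1} = Σ_{k ≤ n+1} p_k u_{n+1-k}`.  Every line on the crux needs a polynomial FLOOR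
`u_L ≥ c L^{-C}`; this file records the NEGATIVE census link: such a floor does not follow from
the abstract renewal structure alone, even with the Kesten-like features "total mass `1`" and "an
atom `p₁ = 1/2` at span `1`".  We exhibit a LACUNARY law `p ≥ 0`, `p₀ = 0`, `p₁ = 1/2`, `Σ p = 1`,
whose renewal sequence dips below `c L^{-C}` for every `C` and every `c > 0`.

CONSTRUCTION.  Atoms at the positions `a₀ = 1`, `a_{s+1} = 2^{s+3} a_s²` (`1, 8, 1024, …`) with
masses `p(a_s) = 2^{-(s+1)}`, `p = 0` elsewhere.  To keep the file free of auxiliary definitions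
the position sequence `a` and the law `p` are carried as hypotheses
(`ha : a 0 = 1 ∧ ∀ s, a (s+1) = 2^(s+3) * a s ^ 2`,
`hp : ∀ k, p k = Σ_{s ≤ k} [k = a s] 2^{-(s+1)}`) of the lemmas in `namespace LacunaryRenewal`,
and instantiated (`Nat.rec`, `rfl`) in the final theorem.

BOUND (pure induction, `LacunaryRenewal.renewal_le_pow`).  If `p ≥ 0`, `p₀ = 0`, the atoms of `p`
below `M` all lie in `[1, K]` and `Σ_{k<M} p_k ≤ r ≤ 1`, then `u_L ≤ r^{⌊L/K⌋}` for all `L < M`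
(strong induction on `L`: `u_L = Σ_k p_k u_{L-k} ≤ (Σ_{k<M} p_k) r^{⌊L/K⌋-1}`).  For the lacunary
law with `M = a_{s+1}`, `K = a_s`, `r = 1 - p(a_{s+1}) = 1 - 2^{-(s+2)}` and
`L = a_s · 2^{s+2} a_s < a_{s+1}` this gives
`u_L ≤ (1 - 2^{-(s+2)})^{2^{s+2} a_s} ≤ exp(-a_s)`, while `L ≤ a_s³` (for `s ≥ 1`); since
`exp(-x) x^{3n} ≤ (3n+1)!/x`, choosing `n ≥ C` and then `s` with `a_s ≥ s > (3n+1)!/c` yields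
`u_L < c L^{-n} ≤ c L^{-C}`.

References (for the renewal structure being modelled; the counterexample itself is elementary):
H. Kesten, *On the number of self-avoiding walks*, J. Math. Phys. 4 (1963), §4; N. Madras,
G. Slade, *The Self-Avoiding Walk* (1993), §4.2, (4.2.2).  Nothing SAW-specific is used: the file
is pure real analysis (the `Literature` import only provides the namespace context of the line).
-/

noncomputable section

namespace Summit.CriticalPhenomena.SAWScalingLimit.Theorems.TubeLowerBound.SubcriticalRenewalFloor

open scoped BigOperators Classical
open Literature.Probability.LatticeModels
open Literature.Probability.RandomPlanarGeometry Literature.Probability.RandomPlanarGeometry.SAW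

namespace LacunaryRenewal

/-! ### Defective renewal sequences decay geometrically on the scale of their largest atom -/

/-- **Geometric decay of a defective renewal sequence.**  Let `p ≥ 0` with `p 0 = 0` and let `u`
solve the renewal recursion `u 0 = 1`, `u (n+1) = Σ_{k ≤ n+1} p k · u (n+1-k)`.  If every atom of
`p` below `M` lies in `[1, K]` (`K ≥ 1`) and `Σ_{k<M} p k ≤ r` with `0 ≤ r ≤ 1`, then
`u L ≤ r ^ (L / K)` for all `L < M` (strong induction on `L`; the `k`-th term of the recursion is
`≤ p k · r^{L/K - 1}` because `(L - k)/K ≥ L/K - 1` for `k ≤ K`). [folklore] -/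
theorem renewal_le_pow {p u : ℕ → ℝ} (hp : ∀ k, 0 ≤ p k) (hp0 : p 0 = 0) (hu0 : u 0 = 1)
    (hrec : ∀ n, u (n + 1) = ∑ k ∈ Finset.range (n + 2), p k * u (n + 1 - k))
    {M K : ℕ} {r : ℝ} (hK : 0 < K) (hr0 : 0 ≤ r) (hr1 : r ≤ 1)
    (hsum : ∑ k ∈ Finset.range M, p k ≤ r) (hsupp : ∀ k, k < M → p k ≠ 0 → k ≤ K) :
    ∀ L, L < M → u L ≤ r ^ (L / K) := by
  intro L
  induction L using Nat.strong_induction_on with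
  | _ L ih =>
  intro hLM
  cases L with
  | zero => simp [hu0]
  | succ n =>
    rw [hrec n]
    have key : ∀ k ∈ Finset.range (n + 2),
        p k * u (n + 1 - k) ≤ p k * r ^ ((n + 1) / K - 1) := by
      intro k hk
      rw [Finset.mem_range] at hk
      by_cases hpk : p k = 0
      · simp [hpk]
      have hkK : k ≤ K := hsupp k (by omega) hpk
      have hk0 : k ≠ 0 := by
        rintro rfl
        exact hpk hp0
      refine mul_le_mul_of_nonneg_left ?_ (hp k)
      calc u (n + 1 - k) ≤ r ^ ((n + 1 - k) / K) := ih _ (by omega) (by omega)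
        _ ≤ r ^ ((n + 1) / K - 1) := by
          apply pow_le_pow_of_le_one hr0 hr1
          have h1 : (n + 1) / K ≤ (n + 1 - k) / K + 1 := by
            rw [← Nat.add_div_right _ hK]
            exact Nat.div_le_div_right (by omega)
          exact Nat.sub_le_iff_le_add.2 h1
    calc ∑ k ∈ Finset.range (n + 2), p k * u (n + 1 - k)
        ≤ ∑ k ∈ Finset.range (n + 2), p k * r ^ ((n + 1) / K - 1) := Finset.sum_le_sum key
      _ = (∑ k ∈ Finset.range (n + 2), p k) * r ^ ((n + 1) / K - 1) := by rw [Finset.sum_mul]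
      _ ≤ r * r ^ ((n + 1) / K - 1) := by
          refine mul_le_mul_of_nonneg_right ?_ (pow_nonneg hr0 _)
          exact le_trans (Finset.sum_le_sum_of_subset_of_nonneg
            (Finset.range_subset_range.2 (by omega)) (fun k _ _ => hp k)) hsum
      _ = r ^ ((n + 1) / K - 1 + 1) := by rw [pow_succ, mul_comm]
      _ ≤ r ^ ((n + 1) / K) := pow_le_pow_of_le_one hr0 hr1 (by omega)

/-! ### The lacunary law

Throughout, `a : ℕ → ℕ` is the position sequence `a 0 = 1`, `a (s+1) = 2^(s+3) * a s ^ 2`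
(hypothesis `ha`) and `p : ℕ → ℝ` is the lacunary law, mass `2^{-(s+1)}` at `a s` and zero
elsewhere, written as the finite sum `p k = Σ_{s ≤ k} [k = a s] (1/2)^(s+1)` (hypothesis `hp`;
the sum may stop at `s = k` because `s ≤ a s`). -/

section

variable {a : ℕ → ℕ} {p : ℕ → ℝ}

/-- The atoms sit at positive positions. [folklore] -/
theorem atom_pos (ha : a 0 = 1 ∧ ∀ s, a (s + 1) = 2 ^ (s + 3) * a s ^ 2) : ∀ s, 0 < a s
  | 0 => by rw [ha.1]; exact Nat.one_pos
  | s + 1 => by rw [ha.2]; exact Nat.mul_pos (pow_pos two_pos _) (pow_pos (atom_pos ha s) 2)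

/-- `2^{s+3} ≤ a_{s+1}`. [folklore] -/
theorem two_pow_le_atom_succ (ha : a 0 = 1 ∧ ∀ s, a (s + 1) = 2 ^ (s + 3) * a s ^ 2) (s : ℕ) :
    2 ^ (s + 1 + 2) ≤ a (s + 1) := by
  rw [ha.2]
  exact Nat.le_mul_of_pos_right _ (pow_pos (atom_pos ha s) 2)

/-- The positions increase: `a_s < a_{s+1}`. [folklore] -/
theorem atom_lt_atom_succ (ha : a 0 = 1 ∧ ∀ s, a (s + 1) = 2 ^ (s + 3) * a s ^ 2) (s : ℕ) :
    a s < a (s + 1) := by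
  rw [ha.2]
  have h1 : 1 ≤ a s := atom_pos ha s
  have h8 : 2 ≤ 2 ^ (s + 3) :=
    calc 2 = 2 ^ 1 := (pow_one 2).symm
      _ ≤ 2 ^ (s + 3) := Nat.pow_le_pow_right (by norm_num) (by omega)
  calc a s < 2 * a s := by omega
    _ ≤ 2 ^ (s + 3) * a s := Nat.mul_le_mul_right _ h8
    _ ≤ 2 ^ (s + 3) * a s ^ 2 :=
        Nat.mul_le_mul_left _ (by rw [pow_two]; exact Nat.le_mul_of_pos_right _ h1)

/-- The positions form a strictly increasing sequence. [folklore] -/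
theorem atom_strictMono (ha : a 0 = 1 ∧ ∀ s, a (s + 1) = 2 ^ (s + 3) * a s ^ 2) : StrictMono a :=
  strictMono_nat_of_lt_succ (atom_lt_atom_succ ha)

/-- `s ≤ a_s`. [folklore] -/
theorem le_atom (ha : a 0 = 1 ∧ ∀ s, a (s + 1) = 2 ^ (s + 3) * a s ^ 2) (s : ℕ) : s ≤ a s :=
  (atom_strictMono ha).le_apply

/-- The lacunary law is nonnegative. [folklore] -/
theorem lac_nonneg
    (hp : ∀ k, p k = ∑ s ∈ Finset.range (k + 1), if k = a s then (1 / 2 : ℝ) ^ (s + 1) else 0)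
    (k : ℕ) : 0 ≤ p k := by
  rw [hp]
  exact Finset.sum_nonneg fun s _ => by
    split_ifs
    · positivity
    · exact le_rfl

/-- The mass at the atom `a_s` is `2^{-(s+1)}`. [folklore] -/
theorem lac_atom (ha : a 0 = 1 ∧ ∀ s, a (s + 1) = 2 ^ (s + 3) * a s ^ 2)
    (hp : ∀ k, p k = ∑ s ∈ Finset.range (k + 1), if k = a s then (1 / 2 : ℝ) ^ (s + 1) else 0)
    (s : ℕ) : p (a s) = (1 / 2 : ℝ) ^ (s + 1) := by
  rw [hp]
  simp only [(atom_strictMono ha).injective.eq_iff, Finset.sum_ite_eq, Finset.mem_range,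
    Nat.lt_succ_iff, le_atom ha, if_true]

/-- Off the atoms the lacunary law vanishes. [folklore] -/
theorem lac_eq_zero
    (hp : ∀ k, p k = ∑ s ∈ Finset.range (k + 1), if k = a s then (1 / 2 : ℝ) ^ (s + 1) else 0)
    {k : ℕ} (hk : k ∉ Set.range a) : p k = 0 := by
  rw [hp]
  exact Finset.sum_eq_zero fun s _ => if_neg fun h => hk ⟨s, h.symm⟩

/-- Mass `1/2` at span `1 = a₀`. [folklore] -/
theorem lac_one (ha : a 0 = 1 ∧ ∀ s, a (s + 1) = 2 ^ (s + 3) * a s ^ 2)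
    (hp : ∀ k, p k = ∑ s ∈ Finset.range (k + 1), if k = a s then (1 / 2 : ℝ) ^ (s + 1) else 0) :
    p 1 = 1 / 2 := by
  have h := lac_atom ha hp 0
  rw [ha.1] at h
  simpa using h

/-- The lacunary law is a probability law: `Σ_k p_k = Σ_s 2^{-(s+1)} = 1`. [folklore] -/
theorem hasSum_lac (ha : a 0 = 1 ∧ ∀ s, a (s + 1) = 2 ^ (s + 3) * a s ^ 2)
    (hp : ∀ k, p k = ∑ s ∈ Finset.range (k + 1), if k = a s then (1 / 2 : ℝ) ^ (s + 1) else 0) :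
    HasSum p 1 := by
  refine ((atom_strictMono ha).injective.hasSum_iff fun k hk => lac_eq_zero hp hk).1 ?_
  have h : HasSum (fun s : ℕ => (1 / 2 : ℝ) * (1 / 2) ^ s) (1 / 2 * 2) :=
    hasSum_geometric_two.mul_left (1 / 2)
  rw [show (1 / 2 : ℝ) * 2 = 1 by norm_num] at h
  convert h using 1
  funext s
  rw [Function.comp_apply, lac_atom ha hp, pow_succ']

/-- Partial sums below the atom `a_{s+1}`: `Σ_{k < a_{s+1}} p_k ≤ 1 - p(a_{s+1}) = 1 - 2^{-(s+2)}`.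
[folklore] -/
theorem sum_range_lac_le (ha : a 0 = 1 ∧ ∀ s, a (s + 1) = 2 ^ (s + 3) * a s ^ 2)
    (hp : ∀ k, p k = ∑ s ∈ Finset.range (k + 1), if k = a s then (1 / 2 : ℝ) ^ (s + 1) else 0)
    (s : ℕ) : ∑ k ∈ Finset.range (a (s + 1)), p k ≤ 1 - (1 / 2 : ℝ) ^ (s + 2) := by
  have h := sum_le_hasSum (Finset.range (a (s + 1) + 1)) (fun k _ => lac_nonneg hp k)
    (hasSum_lac ha hp)
  rw [Finset.sum_range_succ, lac_atom ha hp, show s + 1 + 1 = s + 2 from rfl] at h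
  linarith

/-- The atoms below `a_{s+1}` all lie in `[0, a_s]`. [folklore] -/
theorem le_atom_of_lac_ne_zero (ha : a 0 = 1 ∧ ∀ s, a (s + 1) = 2 ^ (s + 3) * a s ^ 2)
    (hp : ∀ k, p k = ∑ s ∈ Finset.range (k + 1), if k = a s then (1 / 2 : ℝ) ^ (s + 1) else 0)
    {k s : ℕ} (hk : k < a (s + 1)) (h : p k ≠ 0) : k ≤ a s := by
  by_contra hks
  obtain ⟨t, rfl⟩ : k ∈ Set.range a := by
    by_contra h'
    exact h (lac_eq_zero hp h')
  have ht : t < s + 1 := (atom_strictMono ha).lt_iff_lt.1 hk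
  exact hks ((atom_strictMono ha).monotone (Nat.lt_succ_iff.1 ht))

/-! ### The renewal sequence of the lacunary law has no polynomial floor -/

/-- **Decay at the lacunary scales.**  For the renewal sequence `u` of the lacunary law and every
stage `s`, at `L = a_s · (2^{s+2} a_s) < a_{s+1}` one has
`u_L ≤ (1 - 2^{-(s+2)})^{2^{s+2} a_s} ≤ exp(-a_s)`. [folklore] -/
theorem renewal_lac_le (ha : a 0 = 1 ∧ ∀ s, a (s + 1) = 2 ^ (s + 3) * a s ^ 2)
    (hp : ∀ k, p k = ∑ s ∈ Finset.range (k + 1), if k = a s then (1 / 2 : ℝ) ^ (s + 1) else 0)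
    {u : ℕ → ℝ} (hu0 : u 0 = 1)
    (hrec : ∀ n, u (n + 1) = ∑ k ∈ Finset.range (n + 2), p k * u (n + 1 - k)) (s : ℕ) :
    u (a s * (2 ^ (s + 2) * a s)) ≤ Real.exp (-(a s : ℝ)) := by
  have hq0 : (0 : ℝ) ≤ (1 / 2) ^ (s + 2) := by positivity
  have hq1 : (1 / 2 : ℝ) ^ (s + 2) ≤ 1 := pow_le_one₀ (by norm_num) (by norm_num)
  have hLM : a s * (2 ^ (s + 2) * a s) < a (s + 1) := by
    have hpos : 0 < a s * (2 ^ (s + 2) * a s) :=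
      Nat.mul_pos (atom_pos ha s) (Nat.mul_pos (pow_pos two_pos _) (atom_pos ha s))
    have h : a (s + 1) = 2 * (a s * (2 ^ (s + 2) * a s)) := by
      rw [ha.2]; ring
    rw [h]; omega
  have h := renewal_le_pow (lac_nonneg hp) (lac_eq_zero hp fun ⟨t, ht⟩ => (atom_pos ha t).ne' ht)
    hu0 hrec (atom_pos ha s) (sub_nonneg.2 hq1) (sub_le_self 1 hq0) (sum_range_lac_le ha hp s)
    (fun k hk hne => le_atom_of_lac_ne_zero ha hp hk hne) _ hLM
  rw [Nat.mul_div_cancel_left _ (atom_pos ha s)] at h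
  calc u (a s * (2 ^ (s + 2) * a s))
      ≤ (1 - (1 / 2 : ℝ) ^ (s + 2)) ^ (2 ^ (s + 2) * a s) := h
    _ ≤ Real.exp (-(1 / 2 : ℝ) ^ (s + 2)) ^ (2 ^ (s + 2) * a s) :=
        pow_le_pow_left₀ (sub_nonneg.2 hq1) (Real.one_sub_le_exp_neg _) _
    _ = Real.exp (-(a s : ℝ)) := by
        rw [← Real.exp_nat_mul]
        congr 1
        push_cast
        have h2 : (2 : ℝ) ^ (s + 2) * (1 / 2) ^ (s + 2) = 1 := by rw [← mul_pow]; norm_num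
        linear_combination (-(a s : ℝ)) * h2

/-- **No polynomial floor.**  For the renewal sequence `u` of the lacunary law, every `C` and
every `c > 0` there is `L ≥ 1` with `u_L < c L^{-C}`: take `n ≥ C`, a stage `s ≥ 1` with
`a_s ≥ s > (3n+1)!/c`, and `L = 2^{s+2} a_s² ≤ a_s³`; then
`u_L L^n ≤ exp(-a_s) a_s^{3n} ≤ (3n+1)!/a_s < c`. [folklore] -/
theorem exists_renewal_lt (ha : a 0 = 1 ∧ ∀ s, a (s + 1) = 2 ^ (s + 3) * a s ^ 2)
    (hp : ∀ k, p k = ∑ s ∈ Finset.range (k + 1), if k = a s then (1 / 2 : ℝ) ^ (s + 1) else 0)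
    {u : ℕ → ℝ} (hu0 : u 0 = 1)
    (hrec : ∀ n, u (n + 1) = ∑ k ∈ Finset.range (n + 2), p k * u (n + 1 - k)) (C : ℝ) {c : ℝ}
    (hc : 0 < c) : ∃ L : ℕ, 1 ≤ L ∧ u L < c * (L : ℝ) ^ (-C) := by
  obtain ⟨n, hn⟩ : ∃ n : ℕ, C ≤ n := ⟨⌈C⌉₊, Nat.le_ceil C⟩
  set F : ℝ := ((3 * n + 1).factorial : ℝ) with hFdef
  have hF0 : 0 < F := by positivity
  obtain ⟨t, ht⟩ : ∃ t : ℕ, F / c < t + 1 := ⟨⌊F / c⌋₊, Nat.lt_floor_add_one _⟩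
  -- work at the stage `s = t + 1`
  have hx : (0 : ℝ) < a (t + 1) := by exact_mod_cast atom_pos ha (t + 1)
  have hFx : F < c * a (t + 1) := by
    have h1 : ((t + 1 : ℕ) : ℝ) ≤ a (t + 1) := by exact_mod_cast le_atom ha (t + 1)
    push_cast at h1
    rw [div_lt_iff₀ hc] at ht
    calc F < (t + 1) * c := ht
      _ ≤ a (t + 1) * c := mul_le_mul_of_nonneg_right h1 hc.le
      _ = c * a (t + 1) := mul_comm _ _
  have hL0 : 0 < a (t + 1) * (2 ^ (t + 1 + 2) * a (t + 1)) :=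
    Nat.mul_pos (atom_pos ha _) (Nat.mul_pos (pow_pos two_pos _) (atom_pos ha _))
  have hL3 : a (t + 1) * (2 ^ (t + 1 + 2) * a (t + 1)) ≤ a (t + 1) ^ 3 :=
    calc a (t + 1) * (2 ^ (t + 1 + 2) * a (t + 1))
        ≤ a (t + 1) * (a (t + 1) * a (t + 1)) :=
          Nat.mul_le_mul_left _ (Nat.mul_le_mul_right _ (two_pow_le_atom_succ ha t))
      _ = a (t + 1) ^ 3 := by ring
  have hL3' : ((a (t + 1) * (2 ^ (t + 1 + 2) * a (t + 1)) : ℕ) : ℝ) ≤ (a (t + 1) : ℝ) ^ 3 := by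
    exact_mod_cast hL3
  have huL := renewal_lac_le ha hp hu0 hrec (t + 1)
  set L : ℕ := a (t + 1) * (2 ^ (t + 1 + 2) * a (t + 1)) with hLdef
  set x : ℝ := (a (t + 1) : ℝ) with hxdef
  refine ⟨L, Nat.one_le_iff_ne_zero.2 hL0.ne', ?_⟩
  have hLpos : (0 : ℝ) < (L : ℝ) := by exact_mod_cast hL0
  have h1L : (1 : ℝ) ≤ (L : ℝ) := by exact_mod_cast Nat.one_le_iff_ne_zero.2 hL0.ne'
  have hpow : (L : ℝ) ^ n ≤ x ^ (3 * n) :=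
    calc (L : ℝ) ^ n ≤ (x ^ 3) ^ n := pow_le_pow_left₀ hLpos.le hL3' n
      _ = x ^ (3 * n) := by rw [← pow_mul]
  have hfact : x ^ (3 * n + 1) ≤ Real.exp x * F :=
    (div_le_iff₀ hF0).1 (Real.pow_div_factorial_le_exp x hx.le _)
  have h2 : x ^ (3 * n) < c * Real.exp x := by
    have h4 : x ^ (3 * n) * x < c * Real.exp x * x :=
      calc x ^ (3 * n) * x = x ^ (3 * n + 1) := (pow_succ _ _).symm
        _ ≤ Real.exp x * F := hfact
        _ = F * Real.exp x := mul_comm _ _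
        _ < c * x * Real.exp x := mul_lt_mul_of_pos_right hFx (Real.exp_pos x)
        _ = c * Real.exp x * x := by ring
    exact lt_of_mul_lt_mul_right h4 hx.le
  have hA : ((L : ℝ) ^ n)⁻¹ ≤ (L : ℝ) ^ (-C) := by
    rw [← Real.rpow_natCast, ← Real.rpow_neg hLpos.le]
    exact Real.rpow_le_rpow_of_exponent_le h1L (neg_le_neg hn)
  calc u L ≤ Real.exp (-x) := huL
    _ < c * ((L : ℝ) ^ n)⁻¹ := by
        rw [← div_eq_mul_inv, lt_div_iff₀ (pow_pos hLpos n)]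
        calc Real.exp (-x) * (L : ℝ) ^ n ≤ Real.exp (-x) * x ^ (3 * n) :=
              mul_le_mul_of_nonneg_left hpow (Real.exp_pos _).le
          _ < Real.exp (-x) * (c * Real.exp x) := mul_lt_mul_of_pos_left h2 (Real.exp_pos _)
          _ = c := by rw [Real.exp_neg, mul_comm c, inv_mul_cancel_left₀ (Real.exp_pos x).ne']
    _ ≤ c * (L : ℝ) ^ (-C) := mul_le_mul_of_nonneg_left hA hc.le

end

end LacunaryRenewal

open LacunaryRenewal in
/-- **Anti-lacunarity is a genuine extra input** (registered sub-goal
`lacunaryRenewal_noPolynomialFloor` of the crux item, NEGATIVE census link).  There is a law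
`p ≥ 0` on `ℕ` with `p 0 = 0`, `p 1 = 1/2`, `Σ p = 1` (the lacunary law: mass `2^{-(s+1)}` at
`a_s`, `a₀ = 1`, `a_{s+1} = 2^{s+3} a_s²`, zero elsewhere) whose renewal sequence
(`u 0 = 1`, `u (n+1) = Σ_{k ≤ n+1} p k · u (n+1-k)`) has NO polynomial floor: for every `C` and
every `c > 0` some `u_L`, `L ≥ 1`, is `< c L^{-C}`.  Hence a span-renewal floor for Kesten's
irreducible-bridge law cannot follow from "renewal law of total mass `1` with an atom at span `1`"
alone. [folklore] -/
theorem lacunaryRenewal_noPolynomialFloor :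
    ∃ p : ℕ → ℝ, (∀ k, 0 ≤ p k) ∧ p 0 = 0 ∧ p 1 = 1 / 2 ∧ HasSum p 1 ∧ ∀ u : ℕ → ℝ, u 0 = 1 → (∀ n, u (n + 1) = ∑ k ∈ Finset.range (n + 2), p k * u (n + 1 - k)) → ∀ C c : ℝ, 0 < c → ∃ L : ℕ, 1 ≤ L ∧ u L < c * (L : ℝ) ^ (-C) := by
  obtain ⟨a, ha⟩ : ∃ a : ℕ → ℕ, a 0 = 1 ∧ ∀ s, a (s + 1) = 2 ^ (s + 3) * a s ^ 2 :=
    ⟨fun n => Nat.rec (motive := fun _ => ℕ) 1 (fun s x => 2 ^ (s + 3) * x ^ 2) n, rfl,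
      fun _ => rfl⟩
  obtain ⟨p, hp⟩ : ∃ p : ℕ → ℝ,
      ∀ k, p k = ∑ s ∈ Finset.range (k + 1), if k = a s then (1 / 2 : ℝ) ^ (s + 1) else 0 :=
    ⟨_, fun _ => rfl⟩
  exact ⟨p, lac_nonneg hp, lac_eq_zero hp fun ⟨s, hs⟩ => (atom_pos ha s).ne' hs, lac_one ha hp,
    hasSum_lac ha hp, fun u hu0 hrec C c hc => exists_renewal_lt ha hp hu0 hrec C hc⟩

end Summit.CriticalPhenomena.SAWScalingLimit.Theorems.TubeLowerBound.SubcriticalRenewalFloor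

end
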